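import Literature.NumberTheory.Automorphic.UnitaryGroupOrbitalEulerProduct
import Literature.NumberTheory.Automorphic.LocalUnitaryGroupCongrMeasure
import HarnessLib

/-!
# Euler product of orbital integrals on `U(H)(𝔸_{L⁺,f})` for ARBITRARY admissible local orbital measures
# (the normalisation `m_v(π_v U(H)(𝒪_v)) = 1` of `UnitaryGroupOrbitalEulerProduct` performed inside)

Topic `NumberTheory/Automorphic`; namespace `Literature.NumberTheory.Automorphic` (§1 generic) and `….UnitaryGroup` (§2).
THEOREMS ONLY (no definition, no instance, no named fact, no `sorry`).

§1 (generic, any group `G` acting minimally — e.g. transitively — and continuously on a σ-compact space): a non-zero invariant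
measure gives POSITIVE mass to every non-empty open set (`measure_pos_of_smulInvariant_of_isOpen`, Mathlib's
`measure_isOpen_pos_of_smulInvariant_of_compact_ne_zero` fed with a compact set of non-zero mass from σ-compactness — no
regularity hypothesis); hence for an orbital measure `m` on `G ⧸ C(γ)` (invariant, finite on compacta, `≠ 0`) and a compact
open `K ≤ G`, `0 < m(π K) < ∞` and the RESCALED measure `(m(π K))⁻¹ • m` is admissible with `(m(π K))⁻¹ • m (π K) = 1`
(`smul_measure_image_mk_eq_one`, …); orbital integrals rescale by `orbitalIntegral_smul_measure` (★ `LocalOrbitalIntegral`).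

§2 For a CM field `L`, `H ∈ M_N(L)`, `g ∈ U(H)(𝔸_{L⁺})`: **`UnitaryGroup.exists_orbitalIntegral_finPart_eq_smul_prod_of_ne_zero`**
and its convergence twin **`UnitaryGroup.exists_tendsto_prod_localOrbitalIntegral_finPart_of_ne_zero`** — the Euler product of
★ `UnitaryGroupOrbitalEulerProduct` for ARBITRARY non-zero invariant local orbital measures `m_v` finite on compacta (no
normalisation hypothesis, no exceptional set `S₀`): the local factors appear NORMALISED,
`(m_v(π_v U(H)(𝒪_v)))⁻¹ · localOrbitalIntegral v g_v f_v m_v` — i.e. computed with the rescaled measures of §1 (ruling R-g2-2 of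
PLAN-T1 (g2); referee watch-list W7 «one measure normalisation»: whatever admissible families the transfer relations are stated
for, the Euler product reads them after this explicit rescaling).

Written for the cell `pub/hodgecm-mathlib`, ENGINE T1 line `F0_T1InnerFormTraceIdentity`, plan O13c-Q3 / PLAN-T1 (g2) O2.
HC_CM is proved only modulo the printed citations until rung 0 closes; this file is unconditional.

## References

* S. Gelbart, *Automorphic forms on adele groups*, Ann. of Math. Stud. 83 (1975), (9.13)–(9.14), p. 155 (10.19) [Gelbart1975].
* J. D. Rogawski, *Automorphic Representations of Unitary Groups in Three Variables* (1990), §5.4 p. 72 [Rogawski1990].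
-/

noncomputable section

open MeasureTheory Measure Set Filter Topology NumberField IsDedekindDomain
open Literature.MeasureTheory.Group
open scoped ENNReal NNReal

namespace Literature.NumberTheory.Automorphic

/-! ## §1 Invariant measures charge open sets; rescaling an orbital measure to `m(π K) = 1` -/

section Positivity

variable {G α : Type*} [Group G] [TopologicalSpace α] [MulAction G α] [ContinuousConstSMul G α]
  [MulAction.IsMinimal G α] [SigmaCompactSpace α] [MeasurableSpace α]
  (μ : Measure α) [SMulInvariantMeasure G α μ]

include G in
/-- **A non-zero invariant measure charges every non-empty open set** (minimal — e.g. transitive — continuous action on a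
σ-compact space; no regularity needed: σ-compactness provides a compact set of non-zero mass for Mathlib's
`measure_isOpen_pos_of_smulInvariant_of_compact_ne_zero`). [cite: Gelbart1975, (9.13)] -/
theorem measure_pos_of_smulInvariant_of_isOpen (hμ : μ ≠ 0) {U : Set α} (hU : IsOpen U) (hne : U.Nonempty) :
    0 < μ U := by
  have huniv : μ univ ≠ 0 := by rwa [Ne, Measure.measure_univ_eq_zero]
  rw [← iUnion_compactCovering, Ne, measure_iUnion_null_iff, not_forall] at huniv
  obtain ⟨n, hn⟩ := huniv
  exact measure_isOpen_pos_of_smulInvariant_of_compact_ne_zero G (isCompact_compactCovering α n) hn hU hne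

end Positivity

section Rescale

variable {G : Type*} [Group G] [TopologicalSpace G] [IsTopologicalGroup G] [SecondCountableTopology G]
  [LocallyCompactSpace G] (γ : G)
  [MeasurableSpace (G ⧸ Subgroup.centralizer ({γ} : Set G))]
  (m : Measure (G ⧸ Subgroup.centralizer ({γ} : Set G)))
  [SMulInvariantMeasure G (G ⧸ Subgroup.centralizer ({γ} : Set G)) m] [IsFiniteMeasureOnCompacts m]
  (K : Subgroup G)

omit [IsFiniteMeasureOnCompacts m] in
/-- For an orbital measure `m ≠ 0` (invariant, finite on compacta) and an OPEN subgroup `K`, the image `π(K) ⊆ G ⧸ C(γ)` has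
positive mass. [cite: Gelbart1975, (9.13)] -/
theorem measure_image_mk_pos (hm : m ≠ 0) (hKo : IsOpen (K : Set G)) :
    0 < m ((QuotientGroup.mk : G → G ⧸ Subgroup.centralizer ({γ} : Set G)) '' (K : Set G)) :=
  measure_pos_of_smulInvariant_of_isOpen (G := G) m hm (QuotientGroup.isOpenMap_coe _ hKo) ⟨_, 1, K.one_mem, rfl⟩

omit [IsTopologicalGroup G] [SecondCountableTopology G] [LocallyCompactSpace G]
  [SMulInvariantMeasure G (G ⧸ Subgroup.centralizer ({γ} : Set G)) m] in
/-- For a COMPACT subgroup `K`, the image `π(K)` has finite mass. [cite: Gelbart1975, (9.13)] -/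
theorem measure_image_mk_lt_top (hKc : IsCompact (K : Set G)) :
    m ((QuotientGroup.mk : G → G ⧸ Subgroup.centralizer ({γ} : Set G)) '' (K : Set G)) < ∞ :=
  (hKc.image QuotientGroup.continuous_mk).measure_lt_top

/-- **Rescaling to the normalisation `m(π K) = 1`**: `((m(π K))⁻¹ • m) (π K) = 1` for a compact open subgroup `K` and an
orbital measure `m ≠ 0`. [cite: Gelbart1975, (9.13)] -/
theorem smul_measure_image_mk_eq_one (hm : m ≠ 0) (hKo : IsOpen (K : Set G)) (hKc : IsCompact (K : Set G)) :
    ((m ((QuotientGroup.mk : G → G ⧸ Subgroup.centralizer ({γ} : Set G)) '' (K : Set G)))⁻¹ • m)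
        ((QuotientGroup.mk : G → G ⧸ Subgroup.centralizer ({γ} : Set G)) '' (K : Set G)) = 1 := by
  rw [Measure.smul_apply, smul_eq_mul]
  exact ENNReal.inv_mul_cancel (measure_image_mk_pos γ m K hm hKo).ne' (measure_image_mk_lt_top γ m K hKc).ne

omit [IsTopologicalGroup G] [SecondCountableTopology G] [LocallyCompactSpace G]
  [SMulInvariantMeasure G (G ⧸ Subgroup.centralizer ({γ} : Set G)) m] in
/-- The rescaled measure is finite on compacta. [cite: Gelbart1975, (9.13)] -/
theorem isFiniteMeasureOnCompacts_inv_smul (hpos : 0 < m ((QuotientGroup.mk : G → G ⧸ Subgroup.centralizer ({γ} : Set G)) ''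
      (K : Set G))) :
    IsFiniteMeasureOnCompacts
      ((m ((QuotientGroup.mk : G → G ⧸ Subgroup.centralizer ({γ} : Set G)) '' (K : Set G)))⁻¹ • m) :=
  IsFiniteMeasureOnCompacts.smul m (ENNReal.inv_ne_top.2 hpos.ne')

omit [IsTopologicalGroup G] [SecondCountableTopology G] [LocallyCompactSpace G]
  [SMulInvariantMeasure G (G ⧸ Subgroup.centralizer ({γ} : Set G)) m] in
/-- The rescaled measure is non-zero. [cite: Gelbart1975, (9.13)] -/
theorem inv_smul_ne_zero (hm : m ≠ 0) (hKc : IsCompact (K : Set G)) :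
    (m ((QuotientGroup.mk : G → G ⧸ Subgroup.centralizer ({γ} : Set G)) '' (K : Set G)))⁻¹ • m ≠ 0 := by
  intro h
  have h1 := congrArg (fun μ' : Measure (G ⧸ Subgroup.centralizer ({γ} : Set G)) => μ' univ) h
  simp only [Measure.smul_apply, smul_eq_mul, Measure.coe_zero, Pi.zero_apply, mul_eq_zero, ENNReal.inv_eq_zero,
    Measure.measure_univ_eq_zero] at h1
  rcases h1 with h1 | h1
  · exact (measure_image_mk_lt_top γ m K hKc).ne h1
  · exact hm h1

end Rescale

/-! ## §2 `U(H)(𝔸_{L⁺,f})`: the Euler product for arbitrary admissible local orbital measures -/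

namespace UnitaryGroup

variable (L : Type) [Field L] [NumberField L] [IsCMField L] (N : ℕ) (H : Matrix (Fin N) (Fin N) L)

/-- **Euler product of orbital integrals on `U(H)(𝔸_{L⁺,f})` for ARBITRARY non-zero invariant local orbital measures**
(stabilised form): as `exists_orbitalIntegral_finPart_eq_smul_prod`, with the local factors NORMALISED by the masses
`m_v(π_v U(H)(𝒪_v)) ∈ (0, ∞)` — ONE `c ≠ 0` with
`orbitalIntegral g_f F μ = c · ∏_{v∈S₂} (m_v(π_v U(H)(𝒪_v)))⁻¹ · localOrbitalIntegral v g_v (f v) m_v` for every finite-adelic pure tensor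
`F` (cylinders from `S₁ ⊇ S_{g_f}` on) with `μ`-integrable orbital integrand whose normalised local orbital integrals are `1` off
`S₂`. [cite: Gelbart1975, p. 155 (10.19)] [cite: Rogawski1990, §5.4 p. 72] -/
theorem exists_orbitalIntegral_finPart_eq_smul_prod_of_ne_zero (g : (cmDatum L N H).Adelic)
    [MeasurableSpace (finAdelic (↥(maximalRealSubfield L)) L (IsCMField.complexConj L) N H ⧸ Subgroup.centralizer
      ({(finPart (↥(maximalRealSubfield L)) L (IsCMField.complexConj L) N H g)} :
        Set (finAdelic (↥(maximalRealSubfield L)) L (IsCMField.complexConj L) N H)))]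
    [BorelSpace (finAdelic (↥(maximalRealSubfield L)) L (IsCMField.complexConj L) N H ⧸ Subgroup.centralizer
      ({(finPart (↥(maximalRealSubfield L)) L (IsCMField.complexConj L) N H g)} :
        Set (finAdelic (↥(maximalRealSubfield L)) L (IsCMField.complexConj L) N H)))]
    (μ : Measure (finAdelic (↥(maximalRealSubfield L)) L (IsCMField.complexConj L) N H ⧸ Subgroup.centralizer
      ({(finPart (↥(maximalRealSubfield L)) L (IsCMField.complexConj L) N H g)} :
        Set (finAdelic (↥(maximalRealSubfield L)) L (IsCMField.complexConj L) N H))))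
    [SMulInvariantMeasure (finAdelic (↥(maximalRealSubfield L)) L (IsCMField.complexConj L) N H)
      (finAdelic (↥(maximalRealSubfield L)) L (IsCMField.complexConj L) N H ⧸ Subgroup.centralizer
        ({(finPart (↥(maximalRealSubfield L)) L (IsCMField.complexConj L) N H g)} :
          Set (finAdelic (↥(maximalRealSubfield L)) L (IsCMField.complexConj L) N H))) μ]
    [IsFiniteMeasureOnCompacts μ] (hμ : μ ≠ 0)
    [∀ v, MeasurableSpace ((cmDatum L N H).Local v ⧸ Subgroup.centralizer
      ({((cmDatum L N H).toLocal v g)} : Set ((cmDatum L N H).Local v)))]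
    [∀ v, BorelSpace ((cmDatum L N H).Local v ⧸ Subgroup.centralizer
      ({((cmDatum L N H).toLocal v g)} : Set ((cmDatum L N H).Local v)))]
    (m : ∀ v, Measure ((cmDatum L N H).Local v ⧸ Subgroup.centralizer
      ({((cmDatum L N H).toLocal v g)} : Set ((cmDatum L N H).Local v))))
    [∀ v, SMulInvariantMeasure ((cmDatum L N H).Local v) ((cmDatum L N H).Local v ⧸ Subgroup.centralizer
      ({((cmDatum L N H).toLocal v g)} : Set ((cmDatum L N H).Local v))) (m v)]
    [∀ v, IsFiniteMeasureOnCompacts (m v)] (hm : ∀ v, m v ≠ 0) :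
    ∃ c : ℝ≥0, c ≠ 0 ∧ ∀ (f : ∀ v, (cmDatum L N H).Local v → ℂ)
      (F : finAdelic (↥(maximalRealSubfield L)) L (IsCMField.complexConj L) N H → ℂ)
      (S₁ S₂ : Finset (HeightOneSpectrum (𝓞 ↥(maximalRealSubfield L)))),
      (∀ S : Finset (HeightOneSpectrum (𝓞 ↥(maximalRealSubfield L))), S₁ ⊆ S →
        ∀ b : finAdelic (↥(maximalRealSubfield L)) L (IsCMField.complexConj L) N H,
          (∀ v, v ∉ S → evalPlace (↥(maximalRealSubfield L)) L (IsCMField.complexConj L) N H v b ∈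
            localInt L (IsCMField.complexConj L) N H v) →
          F b = ∏ v ∈ S, f v (localPiEquiv L (IsCMField.complexConj L) N H v
            (evalPlace (↥(maximalRealSubfield L)) L (IsCMField.complexConj L) N H v b))) →
      (∀ v, v ∉ S₁ → evalPlace (↥(maximalRealSubfield L)) L (IsCMField.complexConj L) N H v
        (finPart (↥(maximalRealSubfield L)) L (IsCMField.complexConj L) N H g) ∈ localInt L (IsCMField.complexConj L) N H v) →
      Integrable (descConj (finPart (↥(maximalRealSubfield L)) L (IsCMField.complexConj L) N H g)
        (Subgroup.centralizer ({(finPart (↥(maximalRealSubfield L)) L (IsCMField.complexConj L) N H g)} : Set _))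
        (centralizer_comm _) F) μ →
      (∀ v, v ∉ S₂ → ((m v ((QuotientGroup.mk : (cmDatum L N H).Local v → _) ''
          (cmLocalIntegralLevel L N H v : Set ((cmDatum L N H).Local v))))⁻¹).toReal •
          localOrbitalIntegral L N H v ((cmDatum L N H).toLocal v g) (f v) (m v) = 1) →
        orbitalIntegral (finPart (↥(maximalRealSubfield L)) L (IsCMField.complexConj L) N H g) F μ =
          c • ∏ v ∈ S₂, ((m v ((QuotientGroup.mk : (cmDatum L N H).Local v → _) ''
            (cmLocalIntegralLevel L N H v : Set ((cmDatum L N H).Local v))))⁻¹).toReal •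
            localOrbitalIntegral L N H v ((cmDatum L N H).toLocal v g) (f v) (m v) := by
  -- the rescaled local measures
  have hKco : ∀ v, IsCompact (cmLocalIntegralLevel L N H v : Set ((cmDatum L N H).Local v)) ∧
      IsOpen (cmLocalIntegralLevel L N H v : Set ((cmDatum L N H).Local v)) :=
    fun v => isCompact_isOpen_cmLocalIntegralLevel L N H v
  have hpos : ∀ v, 0 < m v ((QuotientGroup.mk : (cmDatum L N H).Local v → _) ''
      (cmLocalIntegralLevel L N H v : Set ((cmDatum L N H).Local v))) :=
    fun v => measure_image_mk_pos _ (m v) _ (hm v) (hKco v).2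
  haveI : ∀ v, SMulInvariantMeasure ((cmDatum L N H).Local v) ((cmDatum L N H).Local v ⧸ Subgroup.centralizer
      ({((cmDatum L N H).toLocal v g)} : Set ((cmDatum L N H).Local v)))
      ((m v ((QuotientGroup.mk : (cmDatum L N H).Local v → _) ''
        (cmLocalIntegralLevel L N H v : Set ((cmDatum L N H).Local v))))⁻¹ • m v) := fun v => inferInstance
  haveI : ∀ v, IsFiniteMeasureOnCompacts ((m v ((QuotientGroup.mk : (cmDatum L N H).Local v → _) ''
      (cmLocalIntegralLevel L N H v : Set ((cmDatum L N H).Local v))))⁻¹ • m v) :=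
    fun v => isFiniteMeasureOnCompacts_inv_smul _ (m v) _ (hpos v)
  have hm1 : ∀ v, v ∉ (∅ : Finset (HeightOneSpectrum (𝓞 ↥(maximalRealSubfield L)))) →
      ((m v ((QuotientGroup.mk : (cmDatum L N H).Local v → _) ''
        (cmLocalIntegralLevel L N H v : Set ((cmDatum L N H).Local v))))⁻¹ • m v)
        ((QuotientGroup.mk : (cmDatum L N H).Local v → _) ''
          (cmLocalIntegralLevel L N H v : Set ((cmDatum L N H).Local v))) = 1 :=
    fun v _ => smul_measure_image_mk_eq_one _ (m v) _ (hm v) (hKco v).2 (hKco v).1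
  obtain ⟨c, hc0, hc⟩ := exists_orbitalIntegral_finPart_eq_smul_prod L N H g μ hμ
    (fun v => (m v ((QuotientGroup.mk : (cmDatum L N H).Local v → _) ''
      (cmLocalIntegralLevel L N H v : Set ((cmDatum L N H).Local v))))⁻¹ • m v) hm1 (fun v hv => absurd hv (by simp))
  refine ⟨c, hc0, fun f F S₁ S₂ hF hγS hFi hf1 => ?_⟩
  have hresc : ∀ v, localOrbitalIntegral L N H v ((cmDatum L N H).toLocal v g) (f v)
      ((m v ((QuotientGroup.mk : (cmDatum L N H).Local v → _) ''
        (cmLocalIntegralLevel L N H v : Set ((cmDatum L N H).Local v))))⁻¹ • m v) =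
      ((m v ((QuotientGroup.mk : (cmDatum L N H).Local v → _) ''
        (cmLocalIntegralLevel L N H v : Set ((cmDatum L N H).Local v))))⁻¹).toReal •
        localOrbitalIntegral L N H v ((cmDatum L N H).toLocal v g) (f v) (m v) :=
    fun v => orbitalIntegral_smul_measure _ _ _ _
  have key := hc f F S₁ S₂ hF hγS (Finset.empty_subset _) hFi (fun v hv => by rw [hresc]; exact hf1 v hv)
  rw [key]
  exact congrArg _ (Finset.prod_congr rfl fun v _ => hresc v)

/-- **Convergence form for arbitrary admissible local measures**: ONE `c ≠ 0` with
`∏_{v∈T} (m_v(π_v U(H)(𝒪_v)))⁻¹ · localOrbitalIntegral v g_v (f v) m_v ⟶ c⁻¹ · orbitalIntegral g_f F μ` for every finite-adelic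
pure tensor `F` with `μ`-integrable orbital integrand — no normalisation hypothesis and no unramified computation.
[cite: Gelbart1975, p. 155 (10.19)] [cite: Rogawski1990, §5.4 p. 72] -/
theorem exists_tendsto_prod_localOrbitalIntegral_finPart_of_ne_zero (g : (cmDatum L N H).Adelic)
    [MeasurableSpace (finAdelic (↥(maximalRealSubfield L)) L (IsCMField.complexConj L) N H ⧸ Subgroup.centralizer
      ({(finPart (↥(maximalRealSubfield L)) L (IsCMField.complexConj L) N H g)} :
        Set (finAdelic (↥(maximalRealSubfield L)) L (IsCMField.complexConj L) N H)))]
    [BorelSpace (finAdelic (↥(maximalRealSubfield L)) L (IsCMField.complexConj L) N H ⧸ Subgroup.centralizer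
      ({(finPart (↥(maximalRealSubfield L)) L (IsCMField.complexConj L) N H g)} :
        Set (finAdelic (↥(maximalRealSubfield L)) L (IsCMField.complexConj L) N H)))]
    (μ : Measure (finAdelic (↥(maximalRealSubfield L)) L (IsCMField.complexConj L) N H ⧸ Subgroup.centralizer
      ({(finPart (↥(maximalRealSubfield L)) L (IsCMField.complexConj L) N H g)} :
        Set (finAdelic (↥(maximalRealSubfield L)) L (IsCMField.complexConj L) N H))))
    [SMulInvariantMeasure (finAdelic (↥(maximalRealSubfield L)) L (IsCMField.complexConj L) N H)
      (finAdelic (↥(maximalRealSubfield L)) L (IsCMField.complexConj L) N H ⧸ Subgroup.centralizer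
        ({(finPart (↥(maximalRealSubfield L)) L (IsCMField.complexConj L) N H g)} :
          Set (finAdelic (↥(maximalRealSubfield L)) L (IsCMField.complexConj L) N H))) μ]
    [IsFiniteMeasureOnCompacts μ] (hμ : μ ≠ 0)
    [∀ v, MeasurableSpace ((cmDatum L N H).Local v ⧸ Subgroup.centralizer
      ({((cmDatum L N H).toLocal v g)} : Set ((cmDatum L N H).Local v)))]
    [∀ v, BorelSpace ((cmDatum L N H).Local v ⧸ Subgroup.centralizer
      ({((cmDatum L N H).toLocal v g)} : Set ((cmDatum L N H).Local v)))]
    (m : ∀ v, Measure ((cmDatum L N H).Local v ⧸ Subgroup.centralizer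
      ({((cmDatum L N H).toLocal v g)} : Set ((cmDatum L N H).Local v))))
    [∀ v, SMulInvariantMeasure ((cmDatum L N H).Local v) ((cmDatum L N H).Local v ⧸ Subgroup.centralizer
      ({((cmDatum L N H).toLocal v g)} : Set ((cmDatum L N H).Local v))) (m v)]
    [∀ v, IsFiniteMeasureOnCompacts (m v)] (hm : ∀ v, m v ≠ 0) :
    ∃ c : ℝ≥0, c ≠ 0 ∧ ∀ (f : ∀ v, (cmDatum L N H).Local v → ℂ)
      (F : finAdelic (↥(maximalRealSubfield L)) L (IsCMField.complexConj L) N H → ℂ)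
      (S₁ : Finset (HeightOneSpectrum (𝓞 ↥(maximalRealSubfield L)))),
      (∀ S : Finset (HeightOneSpectrum (𝓞 ↥(maximalRealSubfield L))), S₁ ⊆ S →
        ∀ b : finAdelic (↥(maximalRealSubfield L)) L (IsCMField.complexConj L) N H,
          (∀ v, v ∉ S → evalPlace (↥(maximalRealSubfield L)) L (IsCMField.complexConj L) N H v b ∈
            localInt L (IsCMField.complexConj L) N H v) →
          F b = ∏ v ∈ S, f v (localPiEquiv L (IsCMField.complexConj L) N H v
            (evalPlace (↥(maximalRealSubfield L)) L (IsCMField.complexConj L) N H v b))) →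
      (∀ v, v ∉ S₁ → evalPlace (↥(maximalRealSubfield L)) L (IsCMField.complexConj L) N H v
        (finPart (↥(maximalRealSubfield L)) L (IsCMField.complexConj L) N H g) ∈ localInt L (IsCMField.complexConj L) N H v) →
      Integrable (descConj (finPart (↥(maximalRealSubfield L)) L (IsCMField.complexConj L) N H g)
        (Subgroup.centralizer ({(finPart (↥(maximalRealSubfield L)) L (IsCMField.complexConj L) N H g)} : Set _))
        (centralizer_comm _) F) μ →
        Tendsto (fun T : Finset (HeightOneSpectrum (𝓞 ↥(maximalRealSubfield L))) =>
            ∏ v ∈ T, ((m v ((QuotientGroup.mk : (cmDatum L N H).Local v → _) ''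
              (cmLocalIntegralLevel L N H v : Set ((cmDatum L N H).Local v))))⁻¹).toReal •
              localOrbitalIntegral L N H v ((cmDatum L N H).toLocal v g) (f v) (m v)) atTop
          (𝓝 (((c : ℝ)⁻¹) • orbitalIntegral (finPart (↥(maximalRealSubfield L)) L (IsCMField.complexConj L) N H g) F μ)) := by
  have hKco : ∀ v, IsCompact (cmLocalIntegralLevel L N H v : Set ((cmDatum L N H).Local v)) ∧
      IsOpen (cmLocalIntegralLevel L N H v : Set ((cmDatum L N H).Local v)) :=
    fun v => isCompact_isOpen_cmLocalIntegralLevel L N H v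
  have hpos : ∀ v, 0 < m v ((QuotientGroup.mk : (cmDatum L N H).Local v → _) ''
      (cmLocalIntegralLevel L N H v : Set ((cmDatum L N H).Local v))) :=
    fun v => measure_image_mk_pos _ (m v) _ (hm v) (hKco v).2
  haveI : ∀ v, SMulInvariantMeasure ((cmDatum L N H).Local v) ((cmDatum L N H).Local v ⧸ Subgroup.centralizer
      ({((cmDatum L N H).toLocal v g)} : Set ((cmDatum L N H).Local v)))
      ((m v ((QuotientGroup.mk : (cmDatum L N H).Local v → _) ''
        (cmLocalIntegralLevel L N H v : Set ((cmDatum L N H).Local v))))⁻¹ • m v) := fun v => inferInstance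
  haveI : ∀ v, IsFiniteMeasureOnCompacts ((m v ((QuotientGroup.mk : (cmDatum L N H).Local v → _) ''
      (cmLocalIntegralLevel L N H v : Set ((cmDatum L N H).Local v))))⁻¹ • m v) :=
    fun v => isFiniteMeasureOnCompacts_inv_smul _ (m v) _ (hpos v)
  have hm1 : ∀ v, v ∉ (∅ : Finset (HeightOneSpectrum (𝓞 ↥(maximalRealSubfield L)))) →
      ((m v ((QuotientGroup.mk : (cmDatum L N H).Local v → _) ''
        (cmLocalIntegralLevel L N H v : Set ((cmDatum L N H).Local v))))⁻¹ • m v)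
        ((QuotientGroup.mk : (cmDatum L N H).Local v → _) ''
          (cmLocalIntegralLevel L N H v : Set ((cmDatum L N H).Local v))) = 1 :=
    fun v _ => smul_measure_image_mk_eq_one _ (m v) _ (hm v) (hKco v).2 (hKco v).1
  obtain ⟨c, hc0, hc⟩ := exists_tendsto_prod_localOrbitalIntegral_finPart L N H g μ hμ
    (fun v => (m v ((QuotientGroup.mk : (cmDatum L N H).Local v → _) ''
      (cmLocalIntegralLevel L N H v : Set ((cmDatum L N H).Local v))))⁻¹ • m v) hm1 (fun v hv => absurd hv (by simp))
  refine ⟨c, hc0, fun f F S₁ hF hγS hFi => ?_⟩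
  have hresc : ∀ v, localOrbitalIntegral L N H v ((cmDatum L N H).toLocal v g) (f v)
      ((m v ((QuotientGroup.mk : (cmDatum L N H).Local v → _) ''
        (cmLocalIntegralLevel L N H v : Set ((cmDatum L N H).Local v))))⁻¹ • m v) =
      ((m v ((QuotientGroup.mk : (cmDatum L N H).Local v → _) ''
        (cmLocalIntegralLevel L N H v : Set ((cmDatum L N H).Local v))))⁻¹).toReal •
        localOrbitalIntegral L N H v ((cmDatum L N H).toLocal v g) (f v) (m v) :=
    fun v => orbitalIntegral_smul_measure _ _ _ _
  have key := hc f F S₁ hF hγS (Finset.empty_subset _) hFi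
  have hfun : (fun T : Finset (HeightOneSpectrum (𝓞 ↥(maximalRealSubfield L))) =>
      ∏ v ∈ T, localOrbitalIntegral L N H v ((cmDatum L N H).toLocal v g) (f v)
        ((m v ((QuotientGroup.mk : (cmDatum L N H).Local v → _) ''
          (cmLocalIntegralLevel L N H v : Set ((cmDatum L N H).Local v))))⁻¹ • m v)) =
      fun T => ∏ v ∈ T, ((m v ((QuotientGroup.mk : (cmDatum L N H).Local v → _) ''
        (cmLocalIntegralLevel L N H v : Set ((cmDatum L N H).Local v))))⁻¹).toReal •
        localOrbitalIntegral L N H v ((cmDatum L N H).toLocal v g) (f v) (m v) :=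
    funext fun T => Finset.prod_congr rfl fun v _ => hresc v
  rw [hfun] at key
  exact key

end UnitaryGroup

end Literature.NumberTheory.Automorphic

end
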